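/-
Copyright (c) 2026 the pub-hodgecm-mathlib formalisation cell (harness21).  Prover seat hodgecm-mathlib-K2E3-p14 (g7), Track B «K2-LIT» ∕ h413
(`stmt-HodgeConjecture-24833`), line `K2_E3_EllipticInputs`, leaf (nsc-S-A′), brick (E4b) = discharge of `h3cell` of ★ E4a, shared tools (E4b-τ).  2026-09-04.
-/
import Literature.NumberTheory.Automorphic.CompactOpenAveraging       -- ★ `Representation.avgProj`, `avgProj_eq`, `IsLeftTransversal`, `exists_isLeftTransversal`
import Literature.NumberTheory.Automorphic.CompactInductionFrobenius  -- ★ `SmoothInd`, `smoothIndRep`, `toFun_finset_sum_smoothInd`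
import Literature.NumberTheory.Automorphic.ParabolicGL                -- ★ `restrictUnipotentGL`, `unipotentRadicalGL`
import Mathlib.MeasureTheory.Integral.Bochner.Set
import Mathlib.MeasureTheory.Group.Measure
import HarnessLib

/-!
# K2_E3 road (h413), leaf (nsc-S-A′), brick (E4b-τ) — shared analytic tools of the `(B, P_{(2,1)})` cell computations: zero integrals on cosets,
# transversal sums versus Haar integrals, and the averaging projector on induced representations

Cell `pub/hodgecm-mathlib` (D-0151), Track B, seat K2E3-p14 (g7); consumers (E4b-1β) K2E3-p21 (g7) (middle cell kernel) and (E4b-1γ) K2E3-p25 (g2) (open cell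
kernel) — K2 bus 2026-09-04 12:20:05Z «want (E4b-τ)».  `--supports stmt-HodgeConjecture-24833 --as helper`; THEOREMS ONLY (no definition ∕ instance ∕ notation ∕ named
fact ∕ `sorry`); GENERIC (Mathlib-level groups and measures, ★ `SmoothInd`, ★ `restrictUnipotentGL`).  COUNT-NEUTRAL.

THE MATHEMATICS (the «injectivity half» of the cell maps in [BernsteinZelevinsky1977, Thm. 5.2]; [Casselman1995, §6.3]; Jacquet's criterion [BernsteinZelevinsky1976, 2.33]).
* §1 (τ1) **`setIntegral_leftAddCoset_eq_zero_of_support_subset`** ∕ **`setIntegral_leftCoset_eq_zero_of_support_subset`**: if `h` is supported in ONE coset `y₁ + L` of a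
  subgroup `L` and `∫ h = 0`, then `∫_{y₀ + L} h = 0` for EVERY coset (cosets are equal or disjoint) — for ANY measure.  This is the elementary averaging lemma
  «`∫ h = 0` ⇒ the average of `h` over every coset of a subgroup containing `supp h − supp h` vanishes».
* §2 (τ2b) **`setIntegral_eq_measureReal_smul_sum_of_isLeftTransversal`**: for a left-invariant measure `μ`, a compact subgroup `K`, an open subgroup `T`, a left transversal
  `R` of `K ⁄ (K ∩ T)` (★ `IsLeftTransversal`) and `Φ` right-`(K ∩ T)`-invariant on the cosets `r (K ∩ T)`, `r ∈ R`:  `∫_K Φ dμ = μ(K ∩ T) · Σ_{r ∈ R} Φ(r)`;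
  `measureReal_eq_card_mul` (`μ(K) = #R · μ(K ∩ T)`) and the AVERAGE form **`average_eq_card_inv_smul_sum_of_isLeftTransversal`**
  (`μ(K)⁻¹ ∫_K Φ = #R⁻¹ Σ_{r∈R} Φ(r)` when `0 < μ(K ∩ T) < ∞`).
* §3 (τ2) the averaging projector ★ `Representation.avgProj` on an induced representation: **`toFun_avgProj_smoothIndRep_eq`** — the VALUE FORMULA
  `(e_S f)(x) = #R⁻¹ Σ_{r ∈ R} f(x r)` — and **`mk_restrictUnipotentGL_avgProj`** — `[e_S v] = [v]` in the Jacquet module `r_c` for a compact `S ≤ U_c` (Jacquet's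
  criterion, easy half: `ρ(r) v ≡ v`).
HONEST LABEL: HC_CM is proved only modulo the 7 printed citations (2 remaining named inputs: hLiu418 = stmt-HodgeConjecture-24832, h413 = stmt-HodgeConjecture-24833)
until rung 0 closes; count-neutral helper.

## Mathlib ∕ tree search
Mathlib `mem_leftCoset_iff`∕`mem_leftAddCoset_iff`, `leftCoset_eq_iff`∕`leftAddCoset_eq_iff`, `MeasureTheory.setIntegral_eq_zero_of_forall_eq_zero`,
`setIntegral_eq_integral_of_forall_compl_eq_zero`, `integral_biUnion_finset`, `MeasurePreserving.setIntegral_image_emb`, `measurePreserving_mul_left`,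
`MeasurableEquiv.mulLeft`, `setIntegral_congr_fun`, `setIntegral_const`, `Representation.Coinvariants.mk_self_apply`; ★ `Representation.avgProj_eq`, ★ `exists_isLeftTransversal`,
★ `IsLeftTransversal.mem_of_mem ∕ existsUnique`, ★ `toFun_finset_sum_smoothInd` (CompactInductionFrobenius), ★ `SmoothInd.toFun_smul ∕ toFun_smoothIndRep_apply`.  Dedup: `rg "leftAddCoset_eq_zero|avgProj_smoothIndRep|restrictUnipotentGL_avgProj"` — no hits.

## References
* [BernsteinZelevinsky1977] I. N. Bernstein, A. V. Zelevinsky, *Induced representations of reductive p-adic groups I*, Ann. Sci. ÉNS 10 (1977), Prop. 1.9, Thm. 5.2.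
* [BernsteinZelevinsky1976] I. N. Bernstein, A. V. Zelevinsky, *Representations of the group GL(n,F) where F is a non-archimedean local field*, Russ. Math. Surveys 31:3 (1976), 2.33.
* [Casselman1995] W. Casselman, *Introduction to the theory of admissible representations of p-adic reductive groups* (draft 1995), §3.3, §6.3.
-/

set_option autoImplicit false
set_option linter.dupNamespace false

noncomputable section

open Function MeasureTheory Representation
open scoped MatrixGroups Pointwise

namespace Summit.HodgeConjecture.HodgeConjecture.Cruxes.H413.K2E3ZeroIntegralCosetAveraging

open Literature.NumberTheory.Automorphic

/-! ## §1 (τ1) A function with zero integral supported in one coset integrates to zero on every coset -/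

section Coset

variable {E : Type*} [NormedAddCommGroup E] [NormedSpace ℝ E]

/-- **(τ1), additive.**  `L` a subgroup of an additive group `A`, `μ` ANY measure on `A`, `h : A → E` with `supp h ⊆ y₁ + L` and `∫ h dμ = 0`; then `∫_{y₀ + L} h dμ = 0`
for every `y₀` (the coset `y₀ + L` either equals `y₁ + L`, and then the set integral is the whole integral, or misses `supp h`).  In the cell computations: `A = F`
(or `F × F`), `L` a compact open ball, `h` the cell function of a class in the kernel of the cell map. [cite: BernsteinZelevinsky1977, Thm. 5.2] [cite: Casselman1995, §6.3] -/
theorem setIntegral_leftAddCoset_eq_zero_of_support_subset {A : Type*} [AddGroup A] [MeasurableSpace A] (μ : Measure A) (L : AddSubgroup A)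
    {h : A → E} {y₁ : A} (hsupp : Function.support h ⊆ y₁ +ᵥ (L : Set A)) (hint : ∫ x, h x ∂μ = 0) (y₀ : A) :
    ∫ x in y₀ +ᵥ (L : Set A), h x ∂μ = 0 := by
  by_cases hy : -y₀ + y₁ ∈ L
  · -- same coset: the set integral is the full integral
    rw [(leftAddCoset_eq_iff L).2 hy, setIntegral_eq_integral_of_forall_compl_eq_zero fun x hx => ?_, hint]
    by_contra hne
    exact hx (hsupp hne)
  · -- disjoint cosets: the integrand vanishes on `y₀ + L`
    refine setIntegral_eq_zero_of_forall_eq_zero fun x hx => ?_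
    by_contra hne
    have hx₁ : x ∈ y₁ +ᵥ (L : Set A) := hsupp hne
    rw [mem_leftAddCoset_iff] at hx hx₁
    refine hy ?_
    have : -y₀ + y₁ = (-y₀ + x) + -(-y₁ + x) := by rw [neg_add_rev, neg_neg, add_assoc, add_neg_cancel_left]
    rw [this]
    exact L.add_mem hx (L.neg_mem hx₁)

/-- **(τ1), multiplicative** (for the unipotent radical `U_P`, written multiplicatively): `supp h ⊆ y₁ · L`, `∫ h dμ = 0` ⇒ `∫_{y₀ · L} h dμ = 0` for every `y₀`.
[cite: BernsteinZelevinsky1977, Thm. 5.2] [cite: Casselman1995, §6.3] -/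
theorem setIntegral_leftCoset_eq_zero_of_support_subset {G : Type*} [Group G] [MeasurableSpace G] (μ : Measure G) (L : Subgroup G)
    {h : G → E} {y₁ : G} (hsupp : Function.support h ⊆ y₁ • (L : Set G)) (hint : ∫ x, h x ∂μ = 0) (y₀ : G) :
    ∫ x in y₀ • (L : Set G), h x ∂μ = 0 := by
  by_cases hy : y₀⁻¹ * y₁ ∈ L
  · rw [(leftCoset_eq_iff L).2 hy, setIntegral_eq_integral_of_forall_compl_eq_zero fun x hx => ?_, hint]
    by_contra hne
    exact hx (hsupp hne)
  · refine setIntegral_eq_zero_of_forall_eq_zero fun x hx => ?_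
    by_contra hne
    have hx₁ : x ∈ y₁ • (L : Set G) := hsupp hne
    rw [mem_leftCoset_iff] at hx hx₁
    refine hy ?_
    have : y₀⁻¹ * y₁ = (y₀⁻¹ * x) * (y₁⁻¹ * x)⁻¹ := by group
    rw [this]
    exact L.mul_mem hx (L.inv_mem hx₁)

end Coset

/-! ## §2 (τ2b) Transversal sums versus integrals over a compact subgroup -/

section Transversal

variable {G : Type*} [Group G] [TopologicalSpace G] [IsTopologicalGroup G] [T2Space G] [MeasurableSpace G] [BorelSpace G]
  {E : Type*} [NormedAddCommGroup E] [NormedSpace ℝ E] [CompleteSpace E]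

omit [TopologicalSpace G] [IsTopologicalGroup G] [T2Space G] [MeasurableSpace G] [BorelSpace G] in
/-- The cosets `r (K ∩ T)`, `r ∈ R`, of a left transversal are pairwise disjoint. [folklore] -/
theorem pairwiseDisjoint_leftCoset_of_isLeftTransversal {K T : Subgroup G} {R : Finset G} (hR : IsLeftTransversal K (K ⊓ T) R) :
    Set.Pairwise (↑R : Set G) (Disjoint on fun r => r • ((K ⊓ T : Subgroup G) : Set G)) := by
  intro r hr r' hr' hne
  refine Set.disjoint_left.2 fun x hx hx' => hne ?_
  rw [mem_leftCoset_iff] at hx hx'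
  have hxK : x ∈ K := by
    have := K.mul_mem (hR.mem_of_mem r hr) hx.1
    rwa [mul_inv_cancel_left] at this
  obtain ⟨r₀, -, huniq⟩ := hR.existsUnique x hxK
  exact (huniq r ⟨hr, hx⟩).trans (huniq r' ⟨hr', hx'⟩).symm

omit [TopologicalSpace G] [IsTopologicalGroup G] [T2Space G] [MeasurableSpace G] [BorelSpace G] in
/-- `K` is the union of the cosets `r (K ∩ T)`, `r ∈ R`. [folklore] -/
theorem coe_eq_biUnion_leftCoset_of_isLeftTransversal {K T : Subgroup G} {R : Finset G} (hR : IsLeftTransversal K (K ⊓ T) R) :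
    (K : Set G) = ⋃ r ∈ R, r • ((K ⊓ T : Subgroup G) : Set G) := by
  ext x
  simp only [Set.mem_iUnion]
  constructor
  · intro hx
    obtain ⟨r, ⟨hr, hrx⟩, -⟩ := hR.existsUnique x hx
    exact ⟨r, hr, (mem_leftCoset_iff r).2 hrx⟩
  · rintro ⟨r, hr, hx⟩
    rw [mem_leftCoset_iff] at hx
    have := K.mul_mem (hR.mem_of_mem r hr) hx.1
    rwa [mul_inv_cancel_left] at this

/-- **(τ2b) TRANSVERSAL SUM = HAAR INTEGRAL.**  `μ` left-invariant, `K` a compact subgroup, `T` an open subgroup, `R` a left transversal of `K ⁄ (K ∩ T)`, `Φ` integrable on `K`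
and right-`(K ∩ T)`-invariant on the cosets of the transversal: `∫_K Φ dμ = μ(K ∩ T) · Σ_{r ∈ R} Φ(r)` (decompose `K = ⊔ r(K ∩ T)`, translate each piece by `r⁻¹`).
[cite: Casselman1995, §2.1, §3.3] -/
theorem setIntegral_eq_measureReal_smul_sum_of_isLeftTransversal (μ : Measure G) [μ.IsMulLeftInvariant] {K T : Subgroup G} (hK : IsCompact (K : Set G))
    (hT : IsOpen (T : Set G)) {R : Finset G} (hR : IsLeftTransversal K (K ⊓ T) R) {Φ : G → E} (hΦ : IntegrableOn Φ (K : Set G) μ)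
    (hinv : ∀ r ∈ R, ∀ s ∈ K ⊓ T, Φ (r * s) = Φ r) :
    ∫ x in (K : Set G), Φ x ∂μ = μ.real ((K ⊓ T : Subgroup G) : Set G) • ∑ r ∈ R, Φ r := by
  have hKTc : IsClosed (((K ⊓ T : Subgroup G) : Set G)) := by
    rw [Subgroup.coe_inf]
    exact hK.isClosed.inter (T.isClosed_of_isOpen hT)
  have hKTm : MeasurableSet (((K ⊓ T : Subgroup G) : Set G)) := hKTc.measurableSet
  have hcos : ∀ r : G, MeasurableSet (r • ((K ⊓ T : Subgroup G) : Set G)) := fun r => hKTm.const_smul r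
  rw [coe_eq_biUnion_leftCoset_of_isLeftTransversal hR, integral_biUnion_finset R (fun r _ => hcos r) (pairwiseDisjoint_leftCoset_of_isLeftTransversal hR)
    fun r hr => hΦ.mono_set ?_, Finset.smul_sum]
  · refine Finset.sum_congr rfl fun r hr => ?_
    -- translate by `r`: `∫_{r S} Φ = ∫_S Φ(r ·) = μ(S) Φ(r)`
    have h1 : ∫ x in r • ((K ⊓ T : Subgroup G) : Set G), Φ x ∂μ = ∫ s in ((K ⊓ T : Subgroup G) : Set G), Φ (r * s) ∂μ := by
      rw [← Set.image_smul, show (fun s : G => r • s) = fun s => r * s from rfl]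
      exact (measurePreserving_mul_left μ r).setIntegral_image_emb (MeasurableEquiv.mulLeft r).measurableEmbedding Φ _
    rw [h1, setIntegral_congr_fun hKTm (fun s hs => hinv r hr s hs), setIntegral_const]
  · intro x hx
    rw [coe_eq_biUnion_leftCoset_of_isLeftTransversal hR]
    exact Set.mem_biUnion hr hx

/-- **Counting measure of a transversal**: `μ(K) = #R · μ(K ∩ T)`. [folklore] -/
theorem measureReal_eq_card_mul_of_isLeftTransversal (μ : Measure G) [μ.IsMulLeftInvariant] [IsFiniteMeasureOnCompacts μ] {K T : Subgroup G}
    (hK : IsCompact (K : Set G)) (hT : IsOpen (T : Set G)) {R : Finset G} (hR : IsLeftTransversal K (K ⊓ T) R) :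
    μ.real (K : Set G) = R.card * μ.real ((K ⊓ T : Subgroup G) : Set G) := by
  have h := setIntegral_eq_measureReal_smul_sum_of_isLeftTransversal μ hK hT hR (Φ := fun _ => (1 : ℝ))
    ((integrableOn_const_iff).2 (Or.inr hK.measure_lt_top)) (fun _ _ _ _ => rfl)
  rw [setIntegral_const, smul_eq_mul, mul_one, Finset.sum_const, nsmul_eq_mul, mul_one, smul_eq_mul] at h
  rw [h, mul_comm]

/-- **(τ2b), AVERAGE FORM**: `μ(K)⁻¹ ∫_K Φ dμ = #R⁻¹ Σ_{r∈R} Φ(r)` when `μ(K ∩ T) ≠ 0` (e.g. `μ` a Haar measure: `K ∩ T` is open in `K`… positive on opens).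
[cite: Casselman1995, §2.1, §3.3] -/
theorem average_eq_card_inv_smul_sum_of_isLeftTransversal (μ : Measure G) [μ.IsMulLeftInvariant] [IsFiniteMeasureOnCompacts μ] {K T : Subgroup G}
    (hK : IsCompact (K : Set G)) (hT : IsOpen (T : Set G)) {R : Finset G} (hR : IsLeftTransversal K (K ⊓ T) R) {Φ : G → E}
    (hΦ : IntegrableOn Φ (K : Set G) μ) (hinv : ∀ r ∈ R, ∀ s ∈ K ⊓ T, Φ (r * s) = Φ r) (hpos : μ.real ((K ⊓ T : Subgroup G) : Set G) ≠ 0) :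
    (μ.real (K : Set G))⁻¹ • ∫ x in (K : Set G), Φ x ∂μ = (R.card : ℝ)⁻¹ • ∑ r ∈ R, Φ r := by
  rw [setIntegral_eq_measureReal_smul_sum_of_isLeftTransversal μ hK hT hR hΦ hinv, measureReal_eq_card_mul_of_isLeftTransversal μ hK hT hR, smul_smul,
    mul_inv, mul_assoc, inv_mul_cancel₀ hpos, mul_one]

end Transversal

/-! ## §3 (τ2) The averaging projector on an induced representation and on the Jacquet module -/

section AvgProj

variable {k : Type*} [Field k] [CharZero k] {G : Type*} [Group G] [TopologicalSpace G] [IsTopologicalGroup G]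
  (H : Subgroup G) {W : Type*} [AddCommGroup W] [Module k W] (σ : Representation k H W)

/-- **(τ2) VALUE FORMULA FOR THE AVERAGING PROJECTOR ON `Ind_H^G σ`**: for a compact subgroup `S`, an open subgroup `T` fixing `f` and a left transversal `R` of
`S ⁄ (S ∩ T)`: `(e_S f)(x) = #R⁻¹ Σ_{r ∈ R} f(x r)` (★ `avgProj_eq` evaluated pointwise). [cite: Casselman1995, §2.1] [cite: BernsteinZelevinsky1976, 2.33] -/
theorem toFun_avgProj_smoothIndRep_eq (f : SmoothInd H σ) {S T : Subgroup G} (hS : IsCompact (S : Set G)) (hT : IsOpen (T : Set G))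
    (hTf : ∀ t ∈ T, smoothIndRep H σ t f = f) {R : Finset G} (hR : IsLeftTransversal S (S ⊓ T) R) (x : G) :
    ((smoothIndRep H σ).avgProj S f).toFun x = (R.card : k)⁻¹ • ∑ r ∈ R, f.toFun (x * r) := by
  rw [avgProj_eq hS hT hTf hR, SmoothInd.toFun_smul, Pi.smul_apply, toFun_finset_sum_smoothInd]
  refine congrArg _ (Finset.sum_congr rfl fun r _ => ?_)
  rw [toFun_smoothIndRep_apply]

omit [CharZero k] in
/-- An open subgroup fixing `f ∈ Ind_H^G σ` always exists (its stabiliser, ★ `isSmooth_smoothInd`), so transversals as in `toFun_avgProj_smoothIndRep_eq` exist for every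
compact `S`. [folklore] -/
theorem exists_isLeftTransversal_stabilizer (f : SmoothInd H σ) {S : Subgroup G} (hS : IsCompact (S : Set G)) :
    ∃ R : Finset G, IsLeftTransversal S (S ⊓ (smoothIndRep H σ).stabilizerSubgroup f) R :=
  exists_isLeftTransversal hS (isSmooth_smoothInd H σ f)

end AvgProj

section Jacquet

variable {F : Type*} [Field F] [TopologicalSpace F] [IsTopologicalRing F] {n : Type*} [Fintype n] [DecidableEq n]
  {α : Type*} [LinearOrder α] (c : n → α)
  {V : Type*} [AddCommGroup V] [Module ℂ V] (π : Representation ℂ (GL n F) V)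

/-- **(τ2) JACQUET'S CRITERION, EASY HALF, FOR `e_S`**: for a compact subgroup `S ≤ U_c` and a smooth vector `v`, the class of `e_S v` in the Jacquet module `r_c π`
(coinvariants of ★ `restrictUnipotentGL F c π`) is the class of `v` (`e_S v = #R⁻¹ Σ ρ(r) v` with `ρ(r) v ≡ v`). [cite: BernsteinZelevinsky1976, 2.33] [cite: Casselman1995, §3.3] -/
theorem mk_restrictUnipotentGL_avgProj {S : Subgroup (GL n F)} (hS : IsCompact (S : Set (GL n F))) (hSU : S ≤ unipotentRadicalGL F c) {v : V}
    (hv : π.IsSmoothVector v) :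
    Coinvariants.mk (restrictUnipotentGL F c π) (π.avgProj S v) = Coinvariants.mk (restrictUnipotentGL F c π) v := by
  classical
  obtain ⟨R, hR⟩ := exists_isLeftTransversal hS hv
  have hstab : ∀ s ∈ π.stabilizerSubgroup v, π s v = v := fun s hs => (π.mem_stabilizerSubgroup v s).1 hs
  rw [avgProj_eq hS hv hstab hR, map_smul, map_sum]
  have hsum : ∑ r ∈ R, Coinvariants.mk (restrictUnipotentGL F c π) (π r v) = ∑ r ∈ R, Coinvariants.mk (restrictUnipotentGL F c π) v :=
    Finset.sum_congr rfl fun r hr => by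
      have hrU : r ∈ unipotentRadicalGL F c := hSU (hR.mem_of_mem r hr)
      obtain ⟨u, hu, hur⟩ := hrU
      have : π r v = restrictUnipotentGL F c π ⟨u, hu⟩ v := by rw [← hur]; rfl
      rw [this, Coinvariants.mk_self_apply]
  have hcard : (R.card : ℂ) ≠ 0 := Nat.cast_ne_zero.2 (Finset.card_ne_zero.2 hR.nonempty)
  rw [hsum, Finset.sum_const, ← Nat.cast_smul_eq_nsmul ℂ, smul_smul, inv_mul_cancel₀ hcard, one_smul]

end Jacquet

end Summit.HodgeConjecture.HodgeConjecture.Cruxes.H413.K2E3ZeroIntegralCosetAveraging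

end
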